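import Literature.Computability.QuantumComplexity.PadDecider
import Literature.Computability.QuantumComplexity.SubroutineUniform
import Literature.Computability.Cryptography.ClassBQPComplementProofs
import HarnessLib

/-!
# Removing a `BQP` oracle from a uniform family, with inverse-polynomial control of EVERY output event

Topic `Literature/Computability/QuantumComplexity`; a repackaging of the tree's proof of Bennett–Bernstein–Brassard–
Vazirani 1997, Cor. 4.15 (`BQP^BQP = BQP`: `OracleSubstitution.lean` — substitute tidy blocks for the oracle gates,
`OracleImpl.kernelProb_substFamily_ge`; `BQPSubroutine.lean` / `PadDecider.lean` — tidy blocks for a `BQP` language,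
`DeciderFamily.tidy_implements`, `exists_uniform_deciderFamily`; `SubroutineUniform.lean` — the substituted family is
uniform, `substFamily_isUniform`). The tree's consumer `isQSolvable_of_tidyFamily` states the conclusion for SEARCH
problems (`2/3 + δ`); estimation procedures (acceptance probabilities compared with instance-dependent thresholds,
statistics of the full output) need the same substitution with the KERNEL of the oracle-free family controlled for every
event up to an inverse polynomial:

* **`exists_oracleFree_kernelProb_ge`** — for `A ∈ BQP`, a uniform family `F` with oracle gates and a polynomial
  `s`, there is an oracle-free uniform family `F'` (fresh ancilla wires appended) such that for every input `x` and
  every event `E` on output strings,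
  `F.kernelProb A x {y | y ++ 0^{X(|x|)} ∈ E} − 1/(s(|x|)+1) ≤ F'.kernelProb 0 x E`;
* **`exists_oracleFree_kernelProb_close`** — consequently, for events `E` read on the ORIGINAL output wires
  (`E' = {y' | y'.take (|x| + F.ancillas |x|) ∈ E}`), the two-sided estimate
  `|F'.kernelProb 0 x E' − F.kernelProb A x E| ≤ 1/(s(|x|)+1)`.

Everything here is PROVED; no definition, no named fact.

## References

* C. H. Bennett, E. Bernstein, G. Brassard, U. Vazirani, *Strengths and weaknesses of quantum computing*, SIAM J.
  Comput. 26 (1997) 1510–1523, Thm. 4.14 (tidy subroutines), Cor. 4.15 (`BQP^BQP = BQP`), Thm. 3.1 (close states give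
  close distributions) [BennettBernsteinBrassardVazirani1997].
* E. Bernstein, U. Vazirani, *Quantum complexity theory*, SIAM J. Comput. 26 (1997), §6 (accumulation of errors), §8.3
  [BernsteinVazirani1997].
-/

noncomputable section

namespace Literature.Computability.QuantumComplexity

open _root_.Computability Complexity Cryptography Finset

/-- **Oracle removal with inverse-polynomial control of every output event.** For `A ∈ BQP`, a uniform Clifford+T
family `F` with oracle gates and a polynomial `s`: there is an ORACLE-FREE uniform family `F'`, obtained by substituting
tidy blocks of precision `q(n)` for the oracle gates (`X n` fresh wires appended after `F`'s ancillas), such that for every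
input `x` and event `E`, `F.kernelProb A x {y | y ++ 0^{X |x|} ∈ E} − 1/(s(|x|)+1) ≤ F'.kernelProb 0 x E`.
[cite: BennettBernsteinBrassardVazirani1997, Cor. 4.15 (proof via Thm. 4.14 and Thm. 3.1)] -/
theorem exists_oracleFree_kernelProb_ge {A : Language Bool} (hA : A ∈ BQP) {F : QCircuitFamily cliffordT}
    (hF : F.IsUniform) (s : Polynomial ℕ) :
    ∃ (F' : QCircuitFamily cliffordT) (X : ℕ → ℕ), F'.IsOracleFree ∧ F'.IsUniform ∧
      (∀ n, F'.ancillas n = F.ancillas n + X n) ∧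
      ∀ (x : List Bool) (E : Set (List Bool)),
        F.kernelProb A x {y | y ++ List.replicate (X x.length) false ∈ E} - 1 / (((s.eval x.length : ℕ) : ℝ) + 1) ≤
          F'.kernelProb 0 x E := by
  classical
  obtain ⟨D, hDU, hDfree, hDdec⟩ := exists_uniform_deciderFamily hA
  obtain ⟨p, hp⟩ := QCircuitFamily.IsUniform.isPolySize' hF
  -- precision schedule: numOracle ≤ p(n) blocks, each within 2/(q(n)+1), total ≤ 1/(s(n)+1)
  let q : Polynomial ℕ := 2 * p * (s + 1)
  let S : TidyFamily cliffordT := D.tidy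
  let B : ℕ → OracleImpl cliffordT := fun n => S.fix (q.eval n)
  let ε : ℕ → ℝ := fun n => 2 / (((q.eval n : ℕ) : ℝ) + 1)
  have himp : S.Implements A fun r => 2 / ((r : ℝ) + 1) := D.tidy_implements hDfree hDdec
  have hB : ∀ n, (B n).Implements A (ε n) := fun n => himp (q.eval n)
  have hε : ∀ n, 0 ≤ ε n := fun n => by positivity
  refine ⟨OracleImpl.substFamily F B, fun n => OracleImpl.extra (B n) (F.circ n).gates,
    OracleImpl.substFamily_isOracleFree F B fun n k => (hB n).isOracleFree k,
    substFamily_isUniform q hF (DeciderFamily.tidy_isUniform hDU hDfree), fun n => rfl, fun x E => ?_⟩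
  have hmain := OracleImpl.kernelProb_substFamily_ge F B A ε hε hB x E
  -- the cost of the replaced gates
  have hT : (OracleImpl.numOracle (F.circ x.length).gates : ℝ) ≤ ((p.eval x.length : ℕ) : ℝ) := by
    exact_mod_cast (numOracle_le_size (F.circ x.length)).trans (hp x.length).1
  have hq : (((q.eval x.length : ℕ) : ℝ)) = 2 * ((p.eval x.length : ℕ) : ℝ) * (((s.eval x.length : ℕ) : ℝ) + 1) := by
    simp only [q, Polynomial.eval_mul, Polynomial.eval_add, Polynomial.eval_one, Polynomial.eval_ofNat]
    push_cast
    ring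
  have hcost : (OracleImpl.numOracle (F.circ x.length).gates : ℝ) * ε x.length ≤
      1 / (((s.eval x.length : ℕ) : ℝ) + 1) := by
    have hP : (0 : ℝ) ≤ ((p.eval x.length : ℕ) : ℝ) := Nat.cast_nonneg _
    have hs : (0 : ℝ) < ((s.eval x.length : ℕ) : ℝ) + 1 := by positivity
    have hden : (0 : ℝ) < ((q.eval x.length : ℕ) : ℝ) + 1 := by positivity
    calc (OracleImpl.numOracle (F.circ x.length).gates : ℝ) * ε x.length
        ≤ ((p.eval x.length : ℕ) : ℝ) * ε x.length := mul_le_mul_of_nonneg_right hT (hε _)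
      _ = ((p.eval x.length : ℕ) : ℝ) * 2 / (((q.eval x.length : ℕ) : ℝ) + 1) := by
          simp only [ε]; ring
      _ ≤ 1 / (((s.eval x.length : ℕ) : ℝ) + 1) := by
          rw [div_le_div_iff₀ hden hs, hq]
          nlinarith
  linarith

/-- The output kernel only charges strings of the output length: intersecting an event with
`{y | |y| = |x| + F.ancillas |x|}` does not change its probability. [folklore] -/
private theorem kernelProb_inter_length {G : QGateSet} (F : QCircuitFamily G) (A : Language Bool) (x : List Bool)
    (S : Set (List Bool)) :
    F.kernelProb A x S = F.kernelProb A x (S ∩ {y | y.length = x.length + F.ancillas x.length}) := by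
  classical
  unfold QCircuitFamily.kernelProb
  have hsupp : (F.kernel A x).support ⊆ {y | y.length = x.length + F.ancillas x.length} := by
    intro y hy
    unfold QCircuitFamily.kernel at hy
    obtain ⟨a, -, rfl⟩ := (PMF.mem_support_map_iff _ _ _).1 hy
    simp
  have h1 := (PMF.toOuterMeasure_apply_inter_support (p := F.kernel A x) (s := S)).symm
  have h2 := (PMF.toOuterMeasure_apply_inter_support (p := F.kernel A x)
    (s := S ∩ {y | y.length = x.length + F.ancillas x.length})).symm
  have h3 : S ∩ {y | y.length = x.length + F.ancillas x.length} ∩ (F.kernel A x).support =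
      S ∩ (F.kernel A x).support := by
    rw [Set.inter_assoc, Set.inter_eq_right.2 hsupp]
  rw [h1, h2, h3]

/-- **Two-sided form for events on the original output wires.** In the setting of
`exists_oracleFree_kernelProb_ge`, for an event `E` on the output strings of `F` and its lift
`E' = {y' | y'.take (|x| + F.ancillas |x|) ∈ E}` to the longer outputs of `F'`:
`|F'.kernelProb 0 x E' − F.kernelProb A x E| ≤ 1/(s(|x|)+1)`.
[cite: BennettBernsteinBrassardVazirani1997, Cor. 4.15] [cite: BernsteinVazirani1997, §6] -/
theorem exists_oracleFree_kernelProb_close {A : Language Bool} (hA : A ∈ BQP) {F : QCircuitFamily cliffordT}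
    (hF : F.IsUniform) (s : Polynomial ℕ) :
    ∃ F' : QCircuitFamily cliffordT, F'.IsOracleFree ∧ F'.IsUniform ∧
      ∀ (x : List Bool) (E : Set (List Bool)),
        |F'.kernelProb 0 x {y' | y'.take (x.length + F.ancillas x.length) ∈ E} - F.kernelProb A x E| ≤
          1 / (((s.eval x.length : ℕ) : ℝ) + 1) := by
  classical
  obtain ⟨F', X, hfree, hU, -, hker⟩ := exists_oracleFree_kernelProb_ge hA hF s
  refine ⟨F', hfree, hU, fun x E => ?_⟩
  -- padding then truncating is the identity on strings of the output length
  have hpad : ∀ S : Set (List Bool),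
      F.kernelProb A x {y | y ++ List.replicate (X x.length) false ∈
        {y' : List Bool | y'.take (x.length + F.ancillas x.length) ∈ S}} = F.kernelProb A x S := by
    intro S
    rw [kernelProb_inter_length F A x _, kernelProb_inter_length F A x S]
    congr 1
    ext y
    simp only [Set.mem_inter_iff, Set.mem_setOf_eq]
    constructor
    · rintro ⟨h1, h2⟩
      rw [List.take_append_of_le_length (le_of_eq h2.symm), List.take_of_length_le (le_of_eq h2)] at h1
      exact ⟨h1, h2⟩
    · rintro ⟨h1, h2⟩
      rw [List.take_append_of_le_length (le_of_eq h2.symm), List.take_of_length_le (le_of_eq h2)]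
      exact ⟨h1, h2⟩
  rw [abs_le]
  constructor
  · have h := hker x {y' | y'.take (x.length + F.ancillas x.length) ∈ E}
    rw [hpad E] at h
    linarith
  · have h := hker x {y' | y'.take (x.length + F.ancillas x.length) ∈ Eᶜ}
    rw [hpad Eᶜ] at h
    have hc1 := QCircuitFamily.kernelProb_add_kernelProb_compl F A x E
    have hc2 := QCircuitFamily.kernelProb_add_kernelProb_compl F' 0 x
      {y' | y'.take (x.length + F.ancillas x.length) ∈ E}
    have hset : ({y' : List Bool | y'.take (x.length + F.ancillas x.length) ∈ E})ᶜ =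
        {y' | y'.take (x.length + F.ancillas x.length) ∈ Eᶜ} := by
      ext y'; simp
    rw [hset] at hc2
    linarith

end Literature.Computability.QuantumComplexity

end
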